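import Summits.NavierStokesRegularity.FunctionalMining.StrainMomentRateSup
import HarnessLib

/-!
# FunctionalMining — the `‖ω‖_∞` rate rows `E.q|T_C|C1` of the vorticity moments `Z_q = ∫|ω|^q`, real `q > 2`

Search for candidate a priori estimates; no regularity claim. Cell `pub-nsfunc`, prove seat
(gen 13). The vorticity twin of `StrainMomentRateSup` (NOGO N8's Calderón–Zygmund closure; K0
`multipliers.C1.holder` "`C_H(q) ≤ q √(2/3) C_CZ(q+1)` … `E.q|T_C|C1` control for every `q`"), in
the dictionary's one rate shape `FunctionalRateSupBound` (`StrainEigen.lean`):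

**`VorticityMoment.functionalRateSupBound_rpow`** — for every real `q > 2` there is `C ≥ 0` such
that on `T³ = UnitAddTorus (Fin 3)`, along every classical solution of unforced
Navier–Stokes/Euler (`ν ≥ 0`) on `[a, b]`, at every time `t` with `|ω(t,x)|² ≤ M²` for all `x`
(`M ≥ 0`), every one-sided derivative value `R` of `s ↦ Z_q(u s)` within `[a, b]` at `t` satisfies
`R ≤ C · M · Z_q(u t)`.

Chain (tree inputs only): slice balance `Ż_q ≤ qX − qνI`, `I ≥ 0`
(`VorticityMoment.derivWithin_Zq_le`); `|X| ≤ √2∫|ω|^{q−1}|∇u|²` (`abs_production_le`); Hölder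
(`holder_production_le`); ONE Calderón–Zygmund step and the sup once:
`∫|∇u|^{2q} ≤ K₁∫|ω|^{2q} ≤ K₁M^q∫|ω|^q` (`exists_cz_rpow`, `StrainMoment.norm_curl_rpow_two_mul_le`);
so `R ≤ q√2 K₁^{1/q} M Z_q` (`StrainMoment.holder_sup_chain`). Existential constant (the `L^{2q}`
Calderón–Zygmund constant is not explicit). Also the calibration `q = 2`:
`FunctionalRateSupBound (torusVorticityMoment 2) 2` in every dimension-3 index type, from
Doering–Gibbon's named fact (tree theorem `DoeringGibbon1995_enstrophyRate_le_vorticitySup_holds`)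
and `Z₂ = 2ℰ`. CONTROL rows (closing needs `∫‖ω‖_∞ < ∞`, i.e. Beale–Kato–Majda); the content is the
kernel check.
-/

noncomputable section

open MeasureTheory Finset Set Filter Topology
open scoped InnerProductSpace RealInnerProductSpace ContDiff

namespace Summit.NavierStokesRegularity.FunctionalMining

open Literature.Analysis.FunctionSpaces Literature.Analysis.FunctionSpaces.Torus
  Literature.Analysis.FluidPDE

namespace VorticityMoment

open VorticityL4

/-- **Rows `E.q|T_C|C1` HOLD with some constant for every real `q > 2` (kernel, control rows), on
`T³`.** There is `C ≥ 0` with `FunctionalRateSupBound (torusVorticityMoment q) C`: along every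
classical solution of unforced Navier–Stokes/Euler (`ν ≥ 0`) on `[a, b]`, at every time `t` and for
every pointwise vorticity majorant `M ≥ 0`, every one-sided derivative value `R` of `s ↦ Z_q(u s)`
within `[a, b]` at `t` satisfies `R ≤ C · M · Z_q(u t)`; `C = q √2 K₁^{1/q}` with the vorticity
Calderón–Zygmund constant `K₁` at `2q` (existential). [ours; NOGO N8 / K0 `C1.holder`, tree inputs] -/
theorem functionalRateSupBound_rpow {q : ℝ} (hq : 2 < q) :
    ∃ C : ℝ, 0 ≤ C ∧ FunctionalRateSupBound (d := Fin 3) (torusVorticityMoment q) C := by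
  obtain ⟨K₁, hK₁0, hK₁⟩ := exists_cz_rpow (q := q) (by linarith)
  have hq0 : 0 < q := by linarith
  refine ⟨q * (Real.sqrt 2 * K₁ ^ (1 / q)), by positivity, ?_⟩
  intro _ ν hν a b hab u p hsol t ht M hM hω R hR
  have hut : IsSmooth (u t) := hsol.smooth_velocity.isSmooth_slice ht
  have hdiv : IsDivFree (u t) := hsol.divFree t ht
  -- the derivative value is the `derivWithin`, bounded by the slice form of the balance
  have hF : (fun s => torusVorticityMoment q (u s)) =
      fun s => ∫ x, torusVorticitySqAt (u s) x ^ (q / 2) := rfl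
  obtain ⟨_, hle⟩ := derivWithin_Zq_le hab hν hsol hq ht
  have hUD : UniqueDiffWithinAt ℝ (Icc a b) t := uniqueDiffOn_Icc hab t ht
  have hRD : R = derivWithin (fun s => ∫ x, torusVorticitySqAt (u s) x ^ (q / 2)) (Icc a b) t := by
    rw [← hF]; exact (hR.derivWithin hUD).symm
  rw [← hRD] at hle
  -- opaque names
  obtain ⟨X, hX⟩ : ∃ X : ℝ, X = ∫ x, torusVorticitySqAt (u t) x ^ (q / 2 - 1) *
      torusStretchingDensity (u t) x := ⟨_, rfl⟩
  obtain ⟨I, hI⟩ : ∃ I : ℝ, I = ∫ x, ‖BDSV.curl (u t) x‖ ^ (q - 2) *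
      ∑ k, ‖partialDeriv k (BDSV.curl (u t)) x‖ ^ 2 := ⟨_, rfl⟩
  obtain ⟨F, hFq⟩ : ∃ F : ℝ, F = ∫ x, ‖BDSV.curl (u t) x‖ ^ q := ⟨_, rfl⟩
  obtain ⟨G, hG⟩ : ∃ G : ℝ, G = ∫ x, (∑ k, ‖partialDeriv k (u t) x‖ ^ 2) ^ q := ⟨_, rfl⟩
  obtain ⟨Y, hY⟩ : ∃ Y : ℝ, Y = ∫ x, ‖BDSV.curl (u t) x‖ ^ (q - 1) *
      ∑ k, ‖partialDeriv k (u t) x‖ ^ 2 := ⟨_, rfl⟩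
  rw [← hX, ← hI] at hle
  have hg0 : ∀ x, 0 ≤ ∑ k, ‖partialDeriv k (u t) x‖ ^ 2 := fun x =>
    Finset.sum_nonneg fun k _ => sq_nonneg _
  have hI0 : 0 ≤ I := by
    rw [hI]; exact integral_nonneg fun x => mul_nonneg (Real.rpow_nonneg (norm_nonneg _) _)
      (Finset.sum_nonneg fun k _ => sq_nonneg _)
  have hF0 : 0 ≤ F := by rw [hFq]; exact integral_nonneg fun x => Real.rpow_nonneg (norm_nonneg _) _
  have hG0 : 0 ≤ G := by rw [hG]; exact integral_nonneg fun x => Real.rpow_nonneg (hg0 x) _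
  have hFm : torusVorticityMoment q (u t) = F := by
    rw [torusVorticityMoment_eq_integral_norm_curl, hFq]
  -- (i) `G ≤ K₁ M^q F`: Calderón–Zygmund at `2q` and the sup once
  have hGle : G ≤ K₁ * M ^ q * F := by
    have h1 : G ≤ K₁ * ∫ x, ‖BDSV.curl (u t) x‖ ^ (2 * q) := by rw [hG]; exact hK₁ (u t) hut hdiv
    have hcq : Continuous fun x => ‖BDSV.curl (u t) x‖ ^ q :=
      continuous_norm_curl_rpow hut hq0.le
    have h2 : ∫ x, ‖BDSV.curl (u t) x‖ ^ (2 * q) ≤ M ^ q * F := by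
      rw [hFq, ← integral_const_mul]
      exact integral_mono_of_nonneg (ae_of_all _ fun x => Real.rpow_nonneg (norm_nonneg _) _)
        (hcq.const_mul _ |>.integrable_unitAddTorus)
        (ae_of_all _ fun x => StrainMoment.norm_curl_rpow_two_mul_le (u t) x hM hq0.le (hω x))
    calc G ≤ K₁ * ∫ x, ‖BDSV.curl (u t) x‖ ^ (2 * q) := h1
      _ ≤ K₁ * (M ^ q * F) := mul_le_mul_of_nonneg_left h2 hK₁0
      _ = K₁ * M ^ q * F := by ring
  -- (ii) `|X| ≤ √2 Y`, `Y ≤ F^{(q-1)/q} G^{1/q} ≤ K₁^{1/q} M F`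
  have hXY : |X| ≤ Real.sqrt 2 * Y := by rw [hX, hY]; exact abs_production_le hut hq.le
  have hYle : Y ≤ K₁ ^ (1 / q) * M * F := by
    have h := holder_production_le hut (q := q) (by linarith)
    rw [← hY, ← hFq, ← hG] at h
    exact StrainMoment.holder_sup_chain hF0 hG0 hK₁0 hM hq0 h hGle
  -- (iii) assemble
  rw [hFm]
  have hνI : 0 ≤ q * ν * I := by positivity
  have h2 : 0 ≤ Real.sqrt 2 := Real.sqrt_nonneg 2
  have hXle : X ≤ Real.sqrt 2 * (K₁ ^ (1 / q) * M * F) :=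
    (le_abs_self X).trans (hXY.trans (mul_le_mul_of_nonneg_left hYle h2))
  have h3 := mul_le_mul_of_nonneg_left hXle hq0.le
  nlinarith

/-- **Row `E.q=3|T_C|C1` (kernel, control):** `∃ C ≥ 0, FunctionalRateSupBound (torusVorticityMoment 3) C`
on `T³`. [ours] -/
theorem functionalRateSupBound_three :
    ∃ C : ℝ, 0 ≤ C ∧ FunctionalRateSupBound (d := Fin 3) (torusVorticityMoment 3) C :=
  functionalRateSupBound_rpow (by norm_num)

/-- **Row `E.q=4|T_C|C1` (kernel, control):** `∃ C ≥ 0, FunctionalRateSupBound (torusVorticityMoment 4) C`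
on `T³`. [ours] -/
theorem functionalRateSupBound_four :
    ∃ C : ℝ, 0 ≤ C ∧ FunctionalRateSupBound (d := Fin 3) (torusVorticityMoment 4) C :=
  functionalRateSupBound_rpow (by norm_num)

/-- **Calibration `q = 2` (row `E.q=2|T_C|C1`, every dimension-3 index type):**
`FunctionalRateSupBound (torusVorticityMoment 2) 2` — `Z₂ = 2ℰ` along the solution
(`torusVorticityMoment_two`), so a derivative value `R` of `Z₂` is twice one of `ℰ`, and
Doering–Gibbon's `Ṙ_ℰ ≤ 2Mℰ` (tree theorem `DoeringGibbon1995_enstrophyRate_le_vorticitySup_holds`)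
gives `R ≤ 4Mℰ = 2M Z₂`. [cite: DoeringGibbon1995, (6.5.18); via the tree theorem] -/
theorem functionalRateSupBound_two {d : Type*} [Fintype d] [DecidableEq d] :
    FunctionalRateSupBound (d := d) (torusVorticityMoment 2) 2 := by
  intro hd ν hν a b hab u p hsol t ht M hM hω R hR
  have heq : ∀ s ∈ Icc a b, torusVorticityMoment 2 (u s) = 2 * torusEnstrophy (u s) := fun s hs =>
    torusVorticityMoment_two (hsol.smooth_velocity.isSmooth_slice hs) (hsol.divFree s hs)
  have hR' : HasDerivWithinAt (fun s => 2 * torusEnstrophy (u s)) R (Icc a b) t :=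
    hR.congr_of_mem (fun s hs => (heq s hs).symm) ht
  have hR2 : HasDerivWithinAt (fun s => torusEnstrophy (u s)) (2⁻¹ * R) (Icc a b) t := by
    have h := hR'.const_mul (2⁻¹ : ℝ)
    refine h.congr_of_mem (fun s _ => ?_) ht
    show torusEnstrophy (u s) = 2⁻¹ * (2 * torusEnstrophy (u s))
    ring
  have h := DoeringGibbon1995_enstrophyRate_le_vorticitySup_holds (d := d) hd hν hab hsol t ht M hM
    hω (2⁻¹ * R) hR2
  rw [heq t ht]
  linarith

end VorticityMoment

end Summit.NavierStokesRegularity.FunctionalMining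

end
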